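import Summits.Ventures.PercRepro.ProfilePointedCircuitClassesStarSharpD0D

/-!
# PercRepro — CASE D0 OF `StarNineSharp`, PART E: THE C-POINT OF A RESIDUAL DEMAND IN `H` AND ITS UNIQUENESS
(p5, gen 54; `proofs/P5-GM1.md` §81 (c), rule R4b)

A residual demand `π = {x, y} ⊆ H ∩ X` (`π + e` an ON demand with `π + f ∉ A`) always has a point `z ∈ π` with
`ρ{e, f, z} = 3` and `ρ(X − z) = 4` (`c_point_exists`): if neither endpoint works, one of them, say `x`, lies on
the line `ef` and in the closure of `W₀ := X ∖ π`; then `ρ(π + f) = 3` and `ρ(W₀ + e) = 4` (otherwise `f ∈ cl(W₀)`),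
i.e. `π + f ∈ A`.  Two distinct residual demands `π₁, π₂ ⊆ H` whose triples `{w₀} ∪ π_i` fail the rank condition
`ρ((X − π_i − w₀) + e + f) = 4` cannot coexist (`r4_unique`): `H ∩ X = π₁ ∪ π₂` has three points, the third points
`t_i` lie on the line `ef`, `f ∈ cl(π_i)`, and `H = {e, f} ∪ (π₁ ∪ π₂)` collapses to rank `≤ 2`.
-/

open scoped Matroid

namespace PercRepro.Cogirth

open Finset ThmH Skew Shadow Profile

variable {α : Type} [DecidableEq α] {N : Matroid α} [N.Finite]

section StarSharpD0E

variable {b b' : α}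

/-- Two rank-`≤ 2` sets through a rank-`2` pair have rank-`≤ 2` union (submodularity). -/
theorem rk_union_le_two_of_pair {S T P : Finset α} (hP : P ⊆ S ∩ T) (hP2 : rk N P = 2) (hS : rk N S ≤ 2)
    (hT : rk N T ≤ 2) : rk N (S ∪ T) ≤ 2 := by
  have := rk_union_add_rk_le_of_subset_inter' (N := N) hP
  omega

/-- `{e, f} ⊆ {e, f, x} ∩ {e, f, y}`. -/
theorem pair_ef_subset_inter_efx_efy (e f x y : α) : ({e, f} : Finset α) ⊆ {e, f, x} ∩ {e, f, y} := by
  intro w hw; simp only [mem_insert, mem_singleton, mem_inter] at hw ⊢; tauto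

/-- `π + e ⊆ {e, f, x} ∪ {e, f, y}` for `π = {x, y}`. -/
theorem insert_e_pair_subset_union (e f x y : α) : insert e ({x, y} : Finset α) ⊆ {e, f, x} ∪ {e, f, y} := by
  intro w hw; simp only [mem_insert, mem_singleton, mem_union] at hw ⊢; tauto

/-- `insert e ({f, z} ∪ {z'}) = insert f (insert e {z, z'})`. -/
theorem insert_e_union_eq (e f z z' : α) : insert e (({f, z} : Finset α) ∪ {z'}) = insert f (insert e {z, z'}) := by
  ext w; simp only [mem_insert, mem_union, mem_singleton]; tauto

/-- `{f, z} ∪ {z'} = insert f {z, z'}`. -/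
theorem union_fz_single_eq (f z z' : α) : ({f, z} : Finset α) ∪ {z'} = insert f {z, z'} := by
  ext w; simp only [mem_insert, mem_union, mem_singleton]; tauto

/-- `{e, f, z'} ⊆ insert f (insert e {z, z'})`. -/
theorem efz'_subset (e f z z' : α) : ({e, f, z'} : Finset α) ⊆ insert f (insert e {z, z'}) := by
  intro w hw; simp only [mem_insert, mem_singleton] at hw ⊢; tauto

/-- `insert e W ∪ insert z W = insert z (insert e W)`. -/
theorem insert_union_insert_eq (e z : α) (W : Finset α) : insert e W ∪ insert z W = insert z (insert e W) := by
  ext w; simp only [mem_union, mem_insert]; tauto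

/-- `{e, z} ∪ W = insert z (insert e W)`. -/
theorem pair_union_eq_insert_insert (e z : α) (W : Finset α) : ({e, z} : Finset α) ∪ W = insert z (insert e W) := by
  ext w; simp only [mem_union, mem_insert, mem_singleton]; tauto

/-- `{f, e, z} = {e, f, z}`. -/
theorem triple_swap12 (e f z : α) : ({f, e, z} : Finset α) = {e, f, z} := by
  ext w; simp only [mem_insert, mem_singleton]; tauto

/-- `{x, y} = {y, x}`. -/
theorem pair_comm' (x y : α) : ({x, y} : Finset α) = {y, x} := by
  ext w; simp only [mem_insert, mem_singleton]; tauto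

/-- **THE C-POINT OF A RESIDUAL DEMAND**: for `π ⊆ X` with `ρ(π + e) = 3`, `ρ((X ∖ π) + f) = 4` and `π + f ∉ A`,
some `z ∈ π` has `ρ{e, f, z} = 3` and `ρ(X − z) = 4`. -/
theorem c_point_exists (h : SeriesPair N b b') (hn : (gr N).card = 9)
    {e f : α} (he : e ∈ gr N) (hf : f ∈ gr N) (hef : e ≠ f) (heb : e ≠ b) (heb' : e ≠ b') (hfb : f ≠ b) (hfb' : f ≠ b')
    (hef2 : rk N {e, f} = 2)
    (he1 : ∀ y ∈ ((((gr N).erase b).erase b').erase f).erase e, rk N {e, y} = 2)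
    (hf1 : ∀ y ∈ ((((gr N).erase b).erase b').erase f).erase e, rk N {f, y} = 2)
    (hX : rk N (((((gr N).erase b).erase b').erase f).erase e) = 4)
    {π : Finset α} (hπ : π ⊆ ((((gr N).erase b).erase b').erase f).erase e) (hπ2 : π.card = 2)
    (hY : rk N (insert e π) = 3)
    (hYc : rk N (insert f (((((gr N).erase b).erase b').erase f).erase e \ π)) = 4)
    (hres : ¬ (rk N (insert f π) = 3 ∧ rk N (insert e (((((gr N).erase b).erase b').erase f).erase e \ π)) = 4)) :
    ∃ z ∈ π, rk N {e, f, z} = 3 ∧ rk N ((((((gr N).erase b).erase b').erase f).erase e).erase z) = 4 := by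
  set X := ((((gr N).erase b).erase b').erase f).erase e with hXdef
  have hXE : ((((gr N).erase b).erase b').erase f).erase e ⊆ ((gr N).erase b).erase b' :=
    (erase_subset _ _).trans (erase_subset _ _)
  have hXg : ((((gr N).erase b).erase b').erase f).erase e ⊆ gr N :=
    hXE.trans ((erase_subset _ _).trans (erase_subset _ _))
  have heE : e ∈ ((gr N).erase b).erase b' := mem_erase.2 ⟨heb', mem_erase.2 ⟨heb, he⟩⟩
  have hfE : f ∈ ((gr N).erase b).erase b' := mem_erase.2 ⟨hfb', mem_erase.2 ⟨hfb, hf⟩⟩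
  have hE7 : (((gr N).erase b).erase b').card = 7 := by
    rw [card_erase_of_mem (mem_erase.2 ⟨h.2.2.1.symm, h.2.1⟩), card_erase_of_mem h.1, hn]
  have hXc : X.card = 5 := by
    rw [hXdef, card_erase_of_mem (mem_erase.2 ⟨hef, heE⟩), card_erase_of_mem hfE, hE7]
  obtain ⟨x, y, hxy, rfl⟩ := card_eq_two.1 hπ2
  have hxX : x ∈ X := hπ (mem_insert_self _ _)
  have hyX : y ∈ X := hπ (mem_insert_of_mem (mem_singleton_self _))
  have hxe : x ≠ e := fun h' => (mem_erase.1 hxX).1 h'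
  have hye : y ≠ e := fun h' => (mem_erase.1 hyX).1 h'
  have hxf : x ≠ f := fun h' => (mem_erase.1 (mem_erase.1 hxX).2).1 h'
  have hyf : y ≠ f := fun h' => (mem_erase.1 (mem_erase.1 hyX).2).1 h'
  set W := X \ {x, y} with hWdef
  have hWX : W ⊆ X := sdiff_subset
  have hWg : W ⊆ gr N := hWX.trans hXg
  have hxW : x ∉ W := fun h' => (mem_sdiff.1 h').2 (mem_insert_self _ _)
  have hyW : y ∉ W := fun h' => (mem_sdiff.1 h').2 (mem_insert_of_mem (mem_singleton_self _))
  have hWc : W.card = 3 := by rw [hWdef, card_sdiff_of_subset hπ, hXc, hπ2]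
  have hW3 : rk N W = 3 := by
    have hc : (insert f W).card = 4 := by
      rw [card_insert_of_notMem (fun h' => (mem_erase.1 (mem_erase.1 (mem_sdiff.1 h').1).2).1 rfl), hWc]
    rw [rk_eq_card_of_subset_of_rk_eq_card (M := N) (subset_insert f _) (by rw [hYc, hc]), hWc]
  have eXx : (X).erase x = insert y W := by
    ext w; simp only [mem_erase, mem_insert, hWdef, mem_sdiff, mem_singleton, not_or]
    constructor
    · rintro ⟨hwx, hwX⟩
      by_cases hwy : w = y
      · exact Or.inl hwy
      · exact Or.inr ⟨hwX, hwx, hwy⟩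
    · rintro (rfl | ⟨hwX, hwx, hwy⟩)
      · exact ⟨hxy.symm, hyX⟩
      · exact ⟨hwx, hwX⟩
  have eXy : (X).erase y = insert x W := by
    ext w; simp only [mem_erase, mem_insert, hWdef, mem_sdiff, mem_singleton, not_or]
    constructor
    · rintro ⟨hwy, hwX⟩
      by_cases hwx : w = x
      · exact Or.inl hwx
      · exact Or.inr ⟨hwX, hwx, hwy⟩
    · rintro (rfl | ⟨hwX, hwx, hwy⟩)
      · exact ⟨hxy, hxX⟩
      · exact ⟨hwy, hwX⟩
  -- not both endpoints on the line `ef`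
  have hefxy : ¬ (rk N {e, f, x} ≤ 2 ∧ rk N {e, f, y} ≤ 2) := by
    rintro ⟨h1, h2⟩
    have h3 : rk N ({e, f, x} ∪ {e, f, y}) ≤ 2 :=
      rk_union_le_two_of_pair (P := {e, f}) (pair_ef_subset_inter_efx_efy e f x y) hef2 h1 h2
    have h4 : rk N (insert e {x, y}) ≤ rk N ({e, f, x} ∪ {e, f, y}) :=
      rk_mono' (M := N) (insert_e_pair_subset_union e f x y)
    omega
  -- not both complements of rank `≤ 3`
  have hsub := rk_inter_add_rk_union_le' (M := N) (insert x W) (insert y W)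
  have eI : insert x W ∩ insert y W = W := by
    ext w; simp only [mem_inter, mem_insert]
    constructor
    · rintro ⟨h1 | h1, h2 | h2⟩
      · exact absurd (h1.symm.trans h2) hxy
      · exact h2
      · exact h1
      · exact h1
    · intro hw; exact ⟨Or.inr hw, Or.inr hw⟩
  have eU : insert x W ∪ insert y W = X := by
    ext w; simp only [mem_union, mem_insert, hWdef, mem_sdiff, mem_singleton, not_or]
    constructor
    · rintro ((rfl | hw) | (rfl | hw))
      · exact hxX
      · exact hw.1
      · exact hyX
      · exact hw.1
    · intro hw
      by_cases hwx : w = x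
      · exact Or.inl (Or.inl hwx)
      by_cases hwy : w = y
      · exact Or.inr (Or.inl hwy)
      exact Or.inl (Or.inr ⟨hw, hwx, hwy⟩)
  rw [eI, eU, hW3, hX] at hsub
  have hxle : rk N (insert x W) ≤ 4 := by
    have := rk_le_card' (M := N) (insert x W); rw [card_insert_of_notMem hxW, hWc] at this; exact this
  have hyle : rk N (insert y W) ≤ 4 := by
    have := rk_le_card' (M := N) (insert y W); rw [card_insert_of_notMem hyW, hWc] at this; exact this
  have hefx3 : rk N {e, f, x} ≤ 3 := by
    have := rk_le_card' (M := N) {e, f, x}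
    rw [card_insert_of_notMem (by simp only [mem_insert, mem_singleton, not_or]; exact ⟨hef, hxe.symm⟩),
      card_pair hxf.symm] at this; exact this
  have hefy3 : rk N {e, f, y} ≤ 3 := by
    have := rk_le_card' (M := N) {e, f, y}
    rw [card_insert_of_notMem (by simp only [mem_insert, mem_singleton, not_or]; exact ⟨hef, hye.symm⟩),
      card_pair hyf.symm] at this; exact this
  -- the key step: a point on the line `ef` and in `cl(W)` forces `π + f ∈ A`
  have key : ∀ z z', z ∈ ({x, y} : Finset α) → z' ∈ ({x, y} : Finset α) → z ≠ z' → ({x, y} : Finset α) = {z, z'} →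
      rk N {e, f, z} ≤ 2 → rk N (insert z W) ≤ 3 → rk N {e, f, z'} = 3 → False := by
    intro z z' hz hz' hzz' hπeq hefz hzW hefz'
    have hzX := hπ hz
    have hz'X := hπ hz'
    apply hres
    constructor
    · -- `ρ(π + f) = 3`: `e ∈ cl{f, z}`, so `ρ{f, z, z'} = ρ{e, f, z, z'} ≥ ρ{e, f, z'} = 3`
      have h1 : rk N (insert e {f, z}) = rk N {f, z} := by
        have := hf1 z hzX
        have e1 : insert e ({f, z} : Finset α) = {e, f, z} := rfl
        have hm : rk N {f, z} ≤ rk N {e, f, z} := rk_mono' (M := N) (subset_insert e {f, z})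
        rw [e1]; omega
      have h2 : rk N (insert e ({f, z} ∪ {z'})) = rk N ({f, z} ∪ {z'}) := rk_insert_union_eq_of_rk_insert_eq' h1
      rw [insert_e_union_eq, union_fz_single_eq] at h2
      have h3 : rk N {e, f, z'} ≤ rk N (insert f (insert e {z, z'})) := rk_mono' (M := N) (efz'_subset e f z z')
      have h4 : rk N (insert f {z, z'}) ≤ 3 := by
        have := rk_le_card' (M := N) (insert f {z, z'})
        rw [card_insert_of_notMem (by
            simp only [mem_insert, mem_singleton, not_or]
            constructor
            · intro h'; exact (mem_erase.1 (mem_erase.1 hzX).2).1 h'.symm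
            · intro h'; exact (mem_erase.1 (mem_erase.1 hz'X).2).1 h'.symm), card_pair hzz'] at this
        exact this
      rw [hπeq]; omega
    · -- `ρ(W + e) = 4`: otherwise `e, z ∈ cl(W)` and `f ∈ cl{e, z} ⊆ cl(W)`, contradicting `ρ(W + f) = 4`
      have hWe : rk N (insert e W) ≤ 4 := by
        have := rk_le_card' (M := N) (insert e W)
        rw [card_insert_of_notMem (fun h' => (mem_erase.1 (mem_sdiff.1 h').1).1 rfl), hWc] at this; exact this
      have hWe3 : 3 ≤ rk N (insert e W) := by rw [← hW3]; exact rk_mono' (M := N) (subset_insert _ _)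
      by_contra hne
      have hWe' : rk N (insert e W) = 3 := by omega
      have hs := rk_inter_add_rk_union_le' (M := N) (insert e W) (insert z W)
      have eI' : insert e W ∩ insert z W = W := by
        ext w; simp only [mem_inter, mem_insert]
        constructor
        · rintro ⟨h1 | h1, h2 | h2⟩
          · exact absurd (h1.symm.trans h2) (fun h' => (mem_erase.1 hzX).1 h'.symm)
          · exact h2
          · exact h1
          · exact h1
        · intro hw; exact ⟨Or.inr hw, Or.inr hw⟩
      rw [eI', insert_union_insert_eq, hW3, hWe'] at hs
      -- `f ∈ cl{e, z}`
      have h1 : rk N (insert f {e, z}) = rk N {e, z} := by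
        have := he1 z hzX
        have e1 : insert f ({e, z} : Finset α) = {f, e, z} := rfl
        have hm : rk N {e, z} ≤ rk N {e, f, z} := rk_mono' (M := N) (by
          intro w hw; simp only [mem_insert, mem_singleton] at hw ⊢; tauto)
        rw [e1, triple_swap12]; omega
      have h2 : rk N (insert f ({e, z} ∪ W)) = rk N ({e, z} ∪ W) := rk_insert_union_eq_of_rk_insert_eq' h1
      rw [pair_union_eq_insert_insert] at h2
      have h3 : rk N (insert f W) ≤ rk N (insert f (insert z (insert e W))) := rk_mono' (M := N)
        (insert_subset_insert f ((subset_insert e W).trans (subset_insert z _)))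
      have hWe3' : rk N (insert z (insert e W)) ≤ 3 := by omega
      omega
  -- the case analysis
  by_cases hx3 : rk N {e, f, x} = 3
  · by_cases hx4 : rk N (insert y W) = 4
    · exact ⟨x, mem_insert_self _ _, hx3, by rw [eXx]; exact hx4⟩
    · -- `y` must work, else `y` lies on `ef` with `ρ(W + y) ≤ 3`
      by_cases hy3 : rk N {e, f, y} = 3
      · refine ⟨y, mem_insert_of_mem (mem_singleton_self _), hy3, ?_⟩
        rw [eXy]; omega
      · exact (key y x (mem_insert_of_mem (mem_singleton_self _)) (mem_insert_self _ _) hxy.symm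
          (pair_comm' x y) (by omega) (by omega) hx3).elim
  · have hy3 : rk N {e, f, y} = 3 := by
      by_contra hy3
      exact hefxy ⟨by omega, by omega⟩
    by_cases hy4 : rk N (insert x W) = 4
    · exact ⟨y, mem_insert_of_mem (mem_singleton_self _), hy3, by rw [eXy]; exact hy4⟩
    · exact (key x y (mem_insert_self _ _) (mem_insert_of_mem (mem_singleton_self _)) hxy rfl (by omega) (by omega)
        hy3).elim

end StarSharpD0E

end PercRepro.Cogirth
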